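/-
Copyright: the b2b-balaban T⁴-continuum CRUX team, row NE7b OWNER lineage `t4-ne7b-p1` (gen 108). Project licence.
-/
import Mathlib.Analysis.Calculus.ContDiff.Operations
import Mathlib.Analysis.InnerProductSpace.PiL2

/-!
# HESSIAN-SMALLNESS IS LOCAL: a bounded-overlap sum of terms, each Hessian-small in the coordinates it touches, is Hessian-small
# with the OVERLAP constant — `D²(Σ_p P_p)(x)[v,v] ≥ −c·d·‖v‖²` when `D²P_p(x)[v,v] ≥ −c·Σ_{i ∈ S_p} v_i²` and every coordinate
# lies in at most `d` supports `S_p` (row NE7b, node U5c; residual (R2′) family (2), the refuter's BILL item 1 «`λ = 2σ − h` ON `K`»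
# IN KIND: `h ≤ d·c`, `d` = plaquettes per bond)

Cell `pub-balaban`, sub-cell `t4`, spine estimate NE7b (`T4WeightBudget.RelWeightBound`; the cell's OWN estimate — NOT PRINTED in
[Bałaban 1983–89], NOT PROVED).  Crux-route work under `Spine/NE7b/` by the row's OWNER; NOTHING of Bałaban's is named or asserted;
no `T4Continuum/Support` leaf typed; no `def`; zero `sorry`.

WHY.  The windowed convexity road's sockets (`…ConvexWindowVirialSocket`, `…ConvexWindowTiltRecentred`, `…ConvexWindowTiltCentred`)
display the modulus `λ = 2σ − h` ON the window, `h` the Hessian-smallness of the anharmonic remainder `P` ON `K`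
(`…ConvexWindowSuppliers.firstOrderOn_quadratic_add_of_hessianOn`: `∀ x ∈ K, ∀ v, −h‖v‖² ≤ D²P(x)[v,v]`).  Print's remainder is a SUM
OF LOCAL TERMS — one per plaquette, each a function of the few bond variables on that plaquette — and every bond lies in a bounded
number `d` of plaquettes (`d = 2(𝖽−1) = 6` in four dimensions).  The idea seat's by-value study (idea-1 T-71; refuter F463 ★,
ρ-ne7bref-g74-1: per-plaquette cubic Hessian `c_p ≤ 3√3`, lattice constant `c_latt ≤ 18√3 = 6·3√3`) is exactly the double count
«per-term smallness in the touched coordinates × overlap».  This file is that double count AS A THEOREM, so that the (A3) instance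
owes the Hessian letter PER PLAQUETTE (a statement about one local term on its own few coordinates), not for the whole action.

WHAT IS PROVED ([folklore]; Mathlib's `iteratedFDeriv_fun_sum_apply` BY NAME):
* §1 `sum_sum_mem_eq_sum_card_mul`, **`sum_sum_mem_le_of_boundedOverlap`**: for `a_i ≥ 0` and supports `S_p` with every `i` in at
  most `d` of them, `Σ_p Σ_{i ∈ S_p} a_i ≤ d·Σ_i a_i` (double counting).
* §2 `hessian_sum_apply` (`D²(Σ_p P_p)(x)[v,w] = Σ_p D²P_p(x)[v,w]` for `C²` terms), **`hessian_lower_of_boundedOverlap`**: if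
  `−c·Σ_{i ∈ S_p} v_i² ≤ D²P_p(x)[v,v]` for every `p` (each term Hessian-small IN THE COORDINATES IT TOUCHES, `c ≥ 0`), then
  `−(c·d)·‖v‖² ≤ D²(Σ_p P_p)(x)[v,v]`; **`abs_hessian_le_of_boundedOverlap`**: the two-sided version
  `|D²(Σ_p P_p)(x)[v,v]| ≤ c·d·‖v‖²` from `|D²P_p(x)[v,v]| ≤ c·Σ_{i ∈ S_p} v_i²`.
* §3 **`hessianOn_lower_of_boundedOverlap`**: the road's letter ON a window `K` — `∀ x ∈ K, ∀ v, −(c·d)‖v‖² ≤ D²(Σ_p P_p)(x)[v,v]`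
  from the per-term letters ON `K` — ready for `…ConvexWindowSuppliers.firstOrderOn_quadratic_add_of_hessianOn` with `h = c·d`.

NOT HERE (honest): that a term «depends only on the coordinates in `S_p`» is NOT asked as such — the hypothesis is the per-term
Hessian bound in the restricted seminorm `Σ_{i ∈ S_p} v_i²`, which is what such a term satisfies and what the instance proves per
plaquette; the per-plaquette constant `c` by value (idea-1 T-71 ∕ refuter F463: `c_p·M₀ε_k`-class) and print's plaquette structure
((A1c)∕(A3) readings); anything of Bałaban's.  NE7b NOT PRINTED ∕ NOT PROVED; spine PROVED 0∕9; rung (B)+1 on a FINITE torus — NOT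
infinite volume, NOT the mass gap, NOT Clay.
HONEST DEPENDENCY: continuum YM on T⁴ ⇐ BetaPertH ∧ nine spine estimates (0/9 proved); BetaPertH ⇐ (D1) ∧ (D4) ∧ CAP+tail.
-/

set_option autoImplicit false

open Finset

namespace Summit.QuantumFields.BalabanUV.T4Continuum.NE7b.HessianLocality

/-! ## §1 Double counting over bounded-overlap supports -/

section DoubleCount

variable {ι 𝔓 : Type*} [Fintype ι] [Fintype 𝔓] [DecidableEq ι]

/-- `Σ_p Σ_{i ∈ S_p} a_i = Σ_i #{p : i ∈ S_p}·a_i` (exchange of summation). [folklore] -/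
theorem sum_sum_mem_eq_sum_card_mul (S : 𝔓 → Finset ι) (a : ι → ℝ) :
    ∑ p, ∑ i ∈ S p, a i = ∑ i, ((Finset.univ.filter fun p => i ∈ S p).card : ℝ) * a i := by
  have e : ∀ p, ∑ i ∈ S p, a i = ∑ i, if i ∈ S p then a i else 0 := fun p => by
    rw [← Finset.sum_filter]; congr 1; ext i; simp
  simp_rw [e]
  rw [Finset.sum_comm]
  refine Finset.sum_congr rfl fun i _ => ?_
  rw [← Finset.sum_filter, Finset.sum_const, nsmul_eq_mul]

/-- **DOUBLE COUNTING WITH BOUNDED OVERLAP**: if every coordinate `i` lies in at most `d` of the supports `S_p` and `a_i ≥ 0`, then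
`Σ_p Σ_{i ∈ S_p} a_i ≤ d·Σ_i a_i`. [folklore] -/
theorem sum_sum_mem_le_of_boundedOverlap (S : 𝔓 → Finset ι) {d : ℕ}
    (hd : ∀ i, (Finset.univ.filter fun p => i ∈ S p).card ≤ d) {a : ι → ℝ} (ha : ∀ i, 0 ≤ a i) :
    ∑ p, ∑ i ∈ S p, a i ≤ (d : ℝ) * ∑ i, a i := by
  rw [sum_sum_mem_eq_sum_card_mul, Finset.mul_sum]
  exact Finset.sum_le_sum fun i _ => mul_le_mul_of_nonneg_right (by exact_mod_cast hd i) (ha i)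

end DoubleCount

/-! ## §2 The Hessian of a bounded-overlap sum of locally Hessian-small terms -/

section Hessian

variable {n : ℕ} {𝔓 : Type*} [Fintype 𝔓]

/-- The Hessian of a finite sum of `C²` terms, evaluated: `D²(Σ_p P_p)(x)[m] = Σ_p D²P_p(x)[m]`. [folklore] -/
theorem hessian_sum_apply (Pp : 𝔓 → EuclideanSpace ℝ (Fin n) → ℝ) (hP : ∀ p, ContDiff ℝ 2 (Pp p))
    (x : EuclideanSpace ℝ (Fin n)) (m : Fin 2 → EuclideanSpace ℝ (Fin n)) :
    iteratedFDeriv ℝ 2 (fun z => ∑ p, Pp p z) x m = ∑ p, iteratedFDeriv ℝ 2 (Pp p) x m := by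
  rw [iteratedFDeriv_fun_sum_apply fun p _ => (hP p).contDiffAt, _root_.sum_apply]

/-- The squared Euclidean norm is the full coordinate sum: `‖v‖² = Σ_i v_i²`. [folklore] -/
theorem norm_sq_eq_sum_sq (v : EuclideanSpace ℝ (Fin n)) : ‖v‖ ^ 2 = ∑ i, v i ^ 2 := by
  rw [EuclideanSpace.norm_eq, Real.sq_sqrt (Finset.sum_nonneg fun i _ => sq_nonneg _)]
  exact Finset.sum_congr rfl fun i _ => by rw [Real.norm_eq_abs, sq_abs]

/-- **HESSIAN-SMALLNESS IS LOCAL (lower bound).**  Terms `P_p ∈ C²` indexed by a finite type, supports `S_p ⊆ Fin n` with every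
coordinate in at most `d` of them, and at the point `x`, for the direction `v`, each term Hessian-small IN THE COORDINATES IT TOUCHES:
`−c·Σ_{i ∈ S_p} v_i² ≤ D²P_p(x)[v,v]` with `c ≥ 0`.  Then `−(c·d)·‖v‖² ≤ D²(Σ_p P_p)(x)[v,v]`. [folklore] -/
theorem hessian_lower_of_boundedOverlap (Pp : 𝔓 → EuclideanSpace ℝ (Fin n) → ℝ) (hP : ∀ p, ContDiff ℝ 2 (Pp p))
    (S : 𝔓 → Finset (Fin n)) {d : ℕ} (hd : ∀ i, (Finset.univ.filter fun p => i ∈ S p).card ≤ d) {c : ℝ} (hc : 0 ≤ c)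
    (x v : EuclideanSpace ℝ (Fin n)) (hH : ∀ p, -c * ∑ i ∈ S p, v i ^ 2 ≤ iteratedFDeriv ℝ 2 (Pp p) x ![v, v]) :
    -(c * d) * ‖v‖ ^ 2 ≤ iteratedFDeriv ℝ 2 (fun z => ∑ p, Pp p z) x ![v, v] := by
  rw [hessian_sum_apply Pp hP, norm_sq_eq_sum_sq]
  have hsum : ∑ p, -c * ∑ i ∈ S p, v i ^ 2 ≤ ∑ p, iteratedFDeriv ℝ 2 (Pp p) x ![v, v] :=
    Finset.sum_le_sum fun p _ => hH p
  have hdc := sum_sum_mem_le_of_boundedOverlap S hd (a := fun i => v i ^ 2) fun i => sq_nonneg _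
  rw [← Finset.mul_sum] at hsum
  nlinarith

/-- **HESSIAN-SMALLNESS IS LOCAL (two-sided).**  With `|D²P_p(x)[v,v]| ≤ c·Σ_{i ∈ S_p} v_i²` for every term:
`|D²(Σ_p P_p)(x)[v,v]| ≤ c·d·‖v‖²`. [folklore] -/
theorem abs_hessian_le_of_boundedOverlap (Pp : 𝔓 → EuclideanSpace ℝ (Fin n) → ℝ) (hP : ∀ p, ContDiff ℝ 2 (Pp p))
    (S : 𝔓 → Finset (Fin n)) {d : ℕ} (hd : ∀ i, (Finset.univ.filter fun p => i ∈ S p).card ≤ d) {c : ℝ} (hc : 0 ≤ c)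
    (x v : EuclideanSpace ℝ (Fin n)) (hH : ∀ p, |iteratedFDeriv ℝ 2 (Pp p) x ![v, v]| ≤ c * ∑ i ∈ S p, v i ^ 2) :
    |iteratedFDeriv ℝ 2 (fun z => ∑ p, Pp p z) x ![v, v]| ≤ c * d * ‖v‖ ^ 2 := by
  rw [hessian_sum_apply Pp hP, norm_sq_eq_sum_sq]
  refine (Finset.abs_sum_le_sum_abs _ _).trans ?_
  refine (Finset.sum_le_sum fun p _ => hH p).trans ?_
  rw [← Finset.mul_sum, mul_assoc]
  exact mul_le_mul_of_nonneg_left (sum_sum_mem_le_of_boundedOverlap S hd fun i => sq_nonneg _) hc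

end Hessian

/-! ## §3 The road's letter ON a window from per-term letters ON the window -/

section Window

variable {n : ℕ} {𝔓 : Type*} [Fintype 𝔓]

/-- **THE HESSIAN LETTER ON THE WINDOW FROM PER-TERM LETTERS** (ready for
`…ConvexWindowSuppliers.firstOrderOn_quadratic_add_of_hessianOn` with `h = c·d`): on a window `K`, if every term satisfies
`−c·Σ_{i ∈ S_p} v_i² ≤ D²P_p(x)[v,v]` for `x ∈ K` and all `v` (`c ≥ 0`), and every coordinate lies in at most `d` supports, then
`∀ x ∈ K, ∀ v, −(c·d)·‖v‖² ≤ D²(Σ_p P_p)(x)[v,v]`. [folklore] -/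
theorem hessianOn_lower_of_boundedOverlap (Pp : 𝔓 → EuclideanSpace ℝ (Fin n) → ℝ) (hP : ∀ p, ContDiff ℝ 2 (Pp p))
    (S : 𝔓 → Finset (Fin n)) {d : ℕ} (hd : ∀ i, (Finset.univ.filter fun p => i ∈ S p).card ≤ d) {c : ℝ} (hc : 0 ≤ c)
    (K : Set (EuclideanSpace ℝ (Fin n)))
    (hH : ∀ p, ∀ x ∈ K, ∀ v : EuclideanSpace ℝ (Fin n), -c * ∑ i ∈ S p, v i ^ 2 ≤ iteratedFDeriv ℝ 2 (Pp p) x ![v, v]) :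
    ∀ x ∈ K, ∀ v : EuclideanSpace ℝ (Fin n), -(c * d) * ‖v‖ ^ 2 ≤ iteratedFDeriv ℝ 2 (fun z => ∑ p, Pp p z) x ![v, v] :=
  fun x hx v => hessian_lower_of_boundedOverlap Pp hP S hd hc x v fun p => hH p x hx v

/-- The sum of `C²` terms is `C²` (the regularity letter of `firstOrderOn_quadratic_add_of_hessianOn` for the sum). [folklore] -/
theorem contDiff_two_sum (Pp : 𝔓 → EuclideanSpace ℝ (Fin n) → ℝ) (hP : ∀ p, ContDiff ℝ 2 (Pp p)) :
    ContDiff ℝ 2 fun z => ∑ p, Pp p z :=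
  ContDiff.sum fun p _ => hP p

end Window

/-!
## §4–§5 (appended gen 108, same seat): LOCAL TERMS THROUGH LINEAR MAPS and the WEIGHTED overlap form

A local term of print's remainder reads the configuration through the restriction `π_p` to the few coordinates it touches:
`P_p = F_p ∘ π_p` with `F_p` a function of those coordinates alone.  §4 is the chain rule `D²(F ∘ π)(x)[v,w] = D²F(π x)[π v, π w]`
and the per-term letter IN THE SEMINORM `‖π v‖` from a Hessian letter on the SMALL factor `F` (at the points `π x`, `x ∈ K` — the
projected window, whose radius is INTENSIVE: refuter κ-ne7bref-g72-4's objection to the global Euclidean radius does not arise);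
§5 is the weighted overlap count `Σ_p h_p‖π_p v‖² ≤ H‖v‖²` ⟹ `−H‖v‖² ≤ D²(Σ_p F_p ∘ π_p)(x)[v,v]` ON `K` — the road's Hessian letter
from per-term letters on the small factors (`hessianOn_lower_of_localTerms`), heterogeneous factor spaces `G p` allowed.
-/

section LocalTerms

variable {n : ℕ} {𝔓 : Type*} [Fintype 𝔓]

/-! ## §4 A term that factors through a linear map: the Hessian letter in the seminorm `‖π v‖` -/

/-- **CHAIN RULE FOR THE HESSIAN THROUGH A LINEAR MAP**: `D²(F ∘ π)(x)[v, w] = D²F(π x)[π v, π w]` for `F ∈ C²` and `π` continuous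
linear (a local term reads the configuration through the restriction `π` to the coordinates it touches). [folklore] -/
theorem hessian_comp_clm_apply {G : Type*} [NormedAddCommGroup G] [NormedSpace ℝ G]
    (π : EuclideanSpace ℝ (Fin n) →L[ℝ] G) {F : G → ℝ} (hF : ContDiff ℝ 2 F) (x v w : EuclideanSpace ℝ (Fin n)) :
    iteratedFDeriv ℝ 2 (fun z => F (π z)) x ![v, w] = iteratedFDeriv ℝ 2 F (π x) ![π v, π w] := by
  have h := π.iteratedFDeriv_comp_right hF x (i := 2) le_rfl
  rw [show (fun z => F (π z)) = F ∘ ⇑π from rfl, h, ContinuousMultilinearMap.compContinuousLinearMap_apply]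
  congr 1
  funext i
  fin_cases i <;> rfl

/-- **THE PER-TERM HESSIAN LETTER FROM THE SMALL FACTOR**: if `F ∈ C²` satisfies `−c‖w‖² ≤ D²F(π x)[w, w]` at the points `π x`,
`x ∈ K`, then the term `F ∘ π` is Hessian-small ON `K` IN THE SEMINORM `‖π v‖`: `−c‖π v‖² ≤ D²(F ∘ π)(x)[v, v]`. [folklore] -/
theorem hessianOn_comp_clm_lower {G : Type*} [NormedAddCommGroup G] [NormedSpace ℝ G]
    (π : EuclideanSpace ℝ (Fin n) →L[ℝ] G) {F : G → ℝ} (hF : ContDiff ℝ 2 F) {c : ℝ} (K : Set (EuclideanSpace ℝ (Fin n)))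
    (hH : ∀ x ∈ K, ∀ w : G, -c * ‖w‖ ^ 2 ≤ iteratedFDeriv ℝ 2 F (π x) ![w, w]) :
    ∀ x ∈ K, ∀ v : EuclideanSpace ℝ (Fin n), -c * ‖π v‖ ^ 2 ≤ iteratedFDeriv ℝ 2 (fun z => F (π z)) x ![v, v] :=
  fun x hx v => by rw [hessian_comp_clm_apply π hF]; exact hH x hx (π v)

/-- The two-sided per-term letter: `|D²F(π x)[w,w]| ≤ c‖w‖²` at the points `π x`, `x ∈ K` ⟹ `|D²(F ∘ π)(x)[v,v]| ≤ c‖π v‖²` ON `K`;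
in particular from the operator norm, `‖D²F(π x)‖ ≤ c`. [folklore] -/
theorem abs_hessianOn_comp_clm_le {G : Type*} [NormedAddCommGroup G] [NormedSpace ℝ G]
    (π : EuclideanSpace ℝ (Fin n) →L[ℝ] G) {F : G → ℝ} (hF : ContDiff ℝ 2 F) {c : ℝ} (K : Set (EuclideanSpace ℝ (Fin n)))
    (hH : ∀ x ∈ K, ‖iteratedFDeriv ℝ 2 F (π x)‖ ≤ c) :
    ∀ x ∈ K, ∀ v : EuclideanSpace ℝ (Fin n), |iteratedFDeriv ℝ 2 (fun z => F (π z)) x ![v, v]| ≤ c * ‖π v‖ ^ 2 := by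
  intro x hx v
  rw [hessian_comp_clm_apply π hF]
  have hop := (iteratedFDeriv ℝ 2 F (π x)).le_opNorm ![π v, π v]
  simp only [Fin.prod_univ_two, Matrix.cons_val_zero, Matrix.cons_val_one, Real.norm_eq_abs] at hop
  calc |iteratedFDeriv ℝ 2 F (π x) ![π v, π v]| ≤ ‖iteratedFDeriv ℝ 2 F (π x)‖ * (‖π v‖ * ‖π v‖) := hop
    _ ≤ c * (‖π v‖ * ‖π v‖) := mul_le_mul_of_nonneg_right (hH x hx) (by positivity)
    _ = c * ‖π v‖ ^ 2 := by ring

/-! ## §5 Weighted overlap: per-term letters in seminorms `s_p(v)` with `Σ_p h_p·s_p(v) ≤ H‖v‖²` -/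

/-- **HESSIAN-SMALLNESS IS LOCAL (weighted seminorm form).**  Terms `P_p ∈ C²`; at `x`, for the direction `v`, each term obeys
`−h_p·s_p ≤ D²P_p(x)[v,v]` for some numbers `s_p` (e.g. `s_p = ‖π_p v‖²`, the energy of `v` on the coordinates the term touches), and the
weighted overlap `Σ_p h_p·s_p ≤ H·‖v‖²`.  Then `−H‖v‖² ≤ D²(Σ_p P_p)(x)[v,v]`. [folklore] -/
theorem hessian_lower_of_weightedOverlap (Pp : 𝔓 → EuclideanSpace ℝ (Fin n) → ℝ) (hP : ∀ p, ContDiff ℝ 2 (Pp p))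
    (x v : EuclideanSpace ℝ (Fin n)) (hterm s : 𝔓 → ℝ) {H : ℝ}
    (hH : ∀ p, -hterm p * s p ≤ iteratedFDeriv ℝ 2 (Pp p) x ![v, v]) (hsum : ∑ p, hterm p * s p ≤ H * ‖v‖ ^ 2) :
    -H * ‖v‖ ^ 2 ≤ iteratedFDeriv ℝ 2 (fun z => ∑ p, Pp p z) x ![v, v] := by
  rw [hessian_sum_apply Pp hP]
  have h := Finset.sum_le_sum fun p (_ : p ∈ Finset.univ) => hH p
  have e : ∑ p, -hterm p * s p = -∑ p, hterm p * s p := by rw [← Finset.sum_neg_distrib]; simp [neg_mul]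
  rw [e] at h
  linarith

/-- **THE SUM OF LOCAL TERMS THROUGH LINEAR MAPS, ON A WINDOW**: `P = Σ_p F_p ∘ π_p` with `F_p ∈ C²`, `−h_p‖w‖² ≤ D²F_p(π_p x)[w,w]`
for `x ∈ K`, and the overlap inequality `Σ_p h_p‖π_p v‖² ≤ H‖v‖²` for all `v` ⟹ `∀ x ∈ K, ∀ v, −H‖v‖² ≤ D²P(x)[v,v]` — the road's
Hessian letter ON `K` (for `…ConvexWindowSuppliers.firstOrderOn_quadratic_add_of_hessianOn`) from PER-TERM letters on the small
factors. [folklore] -/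
theorem hessianOn_lower_of_localTerms {G : 𝔓 → Type*} [∀ p, NormedAddCommGroup (G p)] [∀ p, NormedSpace ℝ (G p)]
    (π : (p : 𝔓) → (EuclideanSpace ℝ (Fin n) →L[ℝ] G p)) (F : (p : 𝔓) → G p → ℝ) (hF : ∀ p, ContDiff ℝ 2 (F p))
    (hterm : 𝔓 → ℝ) {H : ℝ} (K : Set (EuclideanSpace ℝ (Fin n)))
    (hH : ∀ p, ∀ x ∈ K, ∀ w : G p, -hterm p * ‖w‖ ^ 2 ≤ iteratedFDeriv ℝ 2 (F p) (π p x) ![w, w])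
    (hov : ∀ v : EuclideanSpace ℝ (Fin n), ∑ p, hterm p * ‖π p v‖ ^ 2 ≤ H * ‖v‖ ^ 2) :
    ∀ x ∈ K, ∀ v : EuclideanSpace ℝ (Fin n), -H * ‖v‖ ^ 2 ≤ iteratedFDeriv ℝ 2 (fun z => ∑ p, F p (π p z)) x ![v, v] :=
  fun x hx v => hessian_lower_of_weightedOverlap (fun p z => F p (π p z)) (fun p => (hF p).comp (π p).contDiff) x v hterm
    (fun p => ‖π p v‖ ^ 2) (fun p => hessianOn_comp_clm_lower (π p) (hF p) K (hH p) x hx v) (hov v)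

/-- The sum of local terms through linear maps is `C²`. [folklore] -/
theorem contDiff_two_localTerms {G : 𝔓 → Type*} [∀ p, NormedAddCommGroup (G p)] [∀ p, NormedSpace ℝ (G p)]
    (π : (p : 𝔓) → (EuclideanSpace ℝ (Fin n) →L[ℝ] G p)) (F : (p : 𝔓) → G p → ℝ) (hF : ∀ p, ContDiff ℝ 2 (F p)) :
    ContDiff ℝ 2 fun z => ∑ p, F p (π p z) :=
  ContDiff.sum fun p _ => (hF p).comp (π p).contDiff

end LocalTerms

end Summit.QuantumFields.BalabanUV.T4Continuum.NE7b.HessianLocality
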